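import Mathlib
import Summits.Ventures.DiscreteObjects.Mahler.SmythTheorem
import Summits.Ventures.DiscreteObjects.Mahler.SmythIsolationInteger
import Summits.Ventures.DiscreteObjects.Mahler.SmythIsolationJets
import Summits.Ventures.DiscreteObjects.Mahler.SmythIsolationArith
import Summits.Ventures.DiscreteObjects.Mahler.SmythIsolationCoeffBound
import Summits.Ventures.DiscreteObjects.Mahler.SmythIsolationHardy

/-!
# Smyth's theorem, isolation of `θ₀` — the case `ℓ > 2k` (venture `DiscreteObjects`, target L)

Cell `pub-namedobj`, seat `pub-namedobj-mahler` (gen 9). Framing: lottery ticket; floor = certified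
bounds/negative ranges.

Seventh piece of the isolation part of [McKee–Smyth, *Around the Unit Circle*, Thm 12.1] (§12.2.3–12.2.6):
the case in which the nonreciprocity identity of a monic `P` (`P(0) = ε = ±1`) reads
`εP = P*(1 + aX^k) + O(X^{2k+1})` with `a = ±1`.  Writing `D := εP·Q₀(aX^k) - P*·P₀(aX^k) ∈ ℤ[X]`
(`P₀ = 1 - z² + z³`, `Q₀ = 1 - z + z³`): either `D = 0` (and then `M(P) ≤ θ₀`, hence `= θ₀`, for
irreducible `P`, `SmythIsolationInteger`), or the first nonzero coefficient `D_p` (`p ≥ 2k+1`,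
`X_pow_dvd_smythD`) gives `|γ_p - w_p| = c|D_p| ≥ 3/4` for the Taylor coefficients of `f·Q₀(aX^k)` and
`g·P₀(aX^k)` (`jetCoeff_eq_below_and_at`), while Lemmas 12.17–12.19 (`smyth_lemma_12_17`, `smyth_12_49`,
budgets from `hardy_budget_f/g`) give `|γ_p - w_p| ≤ 44√(C - c)` once `C - c < 10⁻³` (`C = θ₀⁻¹`,
`c = 1/M(P)`); so `C - c ≥ (3/176)²` and `M(P) ≥ 1.325`.

* `exists_smythData` — the normalised Blaschke quotients of a monic `P` as a `SmythData`;
* `smyth_relations_re` — the real nonreciprocity relations;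
* `smythTheta_inv_facts`, `intMahlerMeasure_smythQ0a` (`M(Q₀(bX^k)) = θ₀`),
  `intMahlerMeasure_le_of_dvd_reverse_mul`;
* `smyth_isolation_caseB` — **`M(P) = θ₀` or `M(P) ≥ 1.325`** in this case.
-/

namespace Summit.Ventures.DiscreteObjects.Mahler

open Polynomial Metric Set Filter Topology Finset
open scoped ComplexConjugate

noncomputable section

/-! ### Smyth data of a monic integer polynomial -/

/-- The normalised Blaschke quotients of a monic `P` with `P(0) = ε = ±1` and `M(P) > 1`: a Smyth pair
`(f, g, c)` with `c = 1/M(P)` and `f · P* = ε P · g` on the unit disc (extracted from the proof of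
`smythTheta_le_of_monic`). -/
theorem exists_smythData {P : ℤ[X]} (hmonic : P.Monic) {ε : ℤ} (hε : P.coeff 0 = ε) (hε1 : ε * ε = 1)
    (hM1 : 1 < intMahlerMeasure P) :
    ∃ (f g : ℂ → ℂ) (c : ℝ), SmythData f g c ∧ c = (intMahlerMeasure P)⁻¹ ∧
      ∀ z ∈ ball (0 : ℂ) 1, f z * (P.reverse.map (Int.castRingHom ℂ)).eval z =
        (ε : ℂ) * (P.map (Int.castRingHom ℂ)).eval z * g z := by
  obtain ⟨f₀, g₀, hf₀d, hg₀d, hf₀b, hg₀b, hfg₀, hg₀0, hfg₀0, hf₀s, hg₀s⟩ :=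
    exists_blaschke_data_symm hmonic hε hε1
  set M := intMahlerMeasure P
  have hMpos : 0 < M := lt_trans one_pos hM1
  have hg₀real : ((g₀ 0).re : ℂ) = g₀ 0 := by
    apply Complex.conj_eq_iff_re.mp
    have := hg₀s 0
    rw [map_zero] at this
    exact this.symm
  set σ : ℝ := if 0 ≤ (g₀ 0).re then 1 else -1 with hσ
  have hσabs : |σ| = 1 := by rw [hσ]; split_ifs <;> norm_num
  set c : ℝ := σ * (g₀ 0).re with hcdef
  have hcabs : c = |(g₀ 0).re| := by
    rw [hcdef, hσ]; split_ifs with h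
    · rw [one_mul, abs_of_nonneg h]
    · push Not at h; rw [abs_of_neg h]; ring
  have hnorm : ‖g₀ 0‖ = |(g₀ 0).re| := by
    conv_lhs => rw [← hg₀real]
    rw [Complex.norm_real, Real.norm_eq_abs]
  have hcM : c = M⁻¹ := by rw [hcabs, ← hnorm, hg₀0]
  have hcpos : 0 < c := by rw [hcM]; positivity
  have hclt : c < 1 := by rw [hcM]; exact inv_lt_one_of_one_lt₀ hM1
  set f : ℂ → ℂ := fun z => (σ : ℂ) * f₀ z
  set g : ℂ → ℂ := fun z => (σ : ℂ) * g₀ z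
  have hfd : DifferentiableOn ℂ f (ball 0 1) := hf₀d.const_mul _
  have hgd : DifferentiableOn ℂ g (ball 0 1) := hg₀d.const_mul _
  have hσn : ‖(σ : ℂ)‖ = 1 := by rw [Complex.norm_real, Real.norm_eq_abs, hσabs]
  have hfS : IsSchur f := ⟨hfd, fun z hz => by
    show ‖(σ : ℂ) * f₀ z‖ ≤ 1
    rw [norm_mul, hσn, one_mul]; exact hf₀b z hz⟩
  have hgS : IsSchur g := ⟨hgd, fun z hz => by
    show ‖(σ : ℂ) * g₀ z‖ ≤ 1
    rw [norm_mul, hσn, one_mul]; exact hg₀b z hz⟩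
  have hfsym : ∀ z, f (conj z) = conj (f z) := fun z => by
    show (σ : ℂ) * f₀ (conj z) = conj ((σ : ℂ) * f₀ z)
    rw [map_mul, Complex.conj_ofReal, hf₀s]
  have hgsym : ∀ z, g (conj z) = conj (g z) := fun z => by
    show (σ : ℂ) * g₀ (conj z) = conj ((σ : ℂ) * g₀ z)
    rw [map_mul, Complex.conj_ofReal, hg₀s]
  have hfg : ∀ z ∈ ball (0 : ℂ) 1, f z * (P.reverse.map (Int.castRingHom ℂ)).eval z =
      (ε : ℂ) * (P.map (Int.castRingHom ℂ)).eval z * g z := by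
    intro z hz
    show (σ : ℂ) * f₀ z * _ = (ε : ℂ) * _ * ((σ : ℂ) * g₀ z)
    rw [mul_assoc, hfg₀ z hz]; ring
  have hg0 : jetCoeff g 0 = c := by
    rw [jetCoeff_zero]
    show (σ : ℂ) * g₀ 0 = ((σ * (g₀ 0).re : ℝ) : ℂ)
    conv_lhs => rw [← hg₀real]
    push_cast; ring
  have hf0 : jetCoeff f 0 = c := by
    rw [jetCoeff_zero]
    show (σ : ℂ) * f₀ 0 = ((σ * (g₀ 0).re : ℝ) : ℂ)
    rw [hfg₀0]
    conv_lhs => rw [← hg₀real]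
    push_cast; ring
  exact ⟨f, g, c, ⟨hfS, hgS, jetCoeff_conj_of_symm one_pos hfd hfsym, jetCoeff_conj_of_symm one_pos hgd hgsym,
    hf0, hg0, hcpos, hclt⟩, hcM, hfg⟩

/-- The nonreciprocity relations for the real coefficients of a Smyth pair attached to
`εP = P*(1 + aX^k) + bX^ℓ + X^{ℓ+1}R`. -/
theorem smyth_relations_re {P : ℤ[X]} (hmonic : P.Monic) {ε : ℤ} {k ℓ : ℕ} {a b : ℤ} {R : ℤ[X]}
    (hid : C ε * P = P.reverse * (1 + C a * X ^ k) + C b * X ^ ℓ + X ^ (ℓ + 1) * R)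
    {f g : ℂ → ℂ} {c : ℝ} (D : SmythData f g c)
    (hfg : ∀ z ∈ ball (0 : ℂ) 1, f z * (P.reverse.map (Int.castRingHom ℂ)).eval z =
      (ε : ℂ) * (P.map (Int.castRingHom ℂ)).eval z * g z) :
    ∀ n, n ≤ ℓ → (jetCoeff f n).re = (jetCoeff g n).re +
      (if k ≤ n then (a : ℝ) * (jetCoeff g (n - k)).re else 0) + (if n = ℓ then (b : ℝ) * c else 0) := by
  have hrelC := smyth_relations hmonic hid D.hf.differentiableOn D.hg.differentiableOn hfg
  have hg0' : g 0 = (c : ℂ) := by rw [← D.g0, jetCoeff_zero]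
  intro n hn
  have h := congrArg Complex.re (hrelC n hn)
  rw [hg0'] at h
  rw [h, Complex.add_re, Complex.add_re]
  congr 2
  · split_ifs
    · rw [show ((a : ℤ) : ℂ) = ((a : ℝ) : ℂ) by norm_cast, Complex.re_ofReal_mul]
    · simp
  · split_ifs
    · rw [show ((b : ℤ) : ℂ) = ((b : ℝ) : ℂ) by norm_cast, Complex.re_ofReal_mul, Complex.ofReal_re]
    · simp

/-! ### Constants -/

/-- `C₀ = θ₀⁻¹`: `C₀ θ₀ = 1`, `0.7548 < C₀ < 0.7549`, `C₀² + C₀³ = 1`. -/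
theorem smythTheta_inv_facts :
    smythTheta⁻¹ * smythTheta = 1 ∧ (7548 : ℝ) / 10000 < smythTheta⁻¹ ∧ smythTheta⁻¹ < 7549 / 10000 ∧
      smythTheta⁻¹ ^ 2 + smythTheta⁻¹ ^ 3 = 1 := by
  have hpos := smythTheta_pos
  refine ⟨inv_mul_cancel₀ hpos.ne', ?_, ?_, ?_⟩
  · rw [lt_inv_comm₀ (by norm_num) hpos]
    exact lt_trans smythTheta_lt (by norm_num)
  · rw [inv_lt_comm₀ hpos (by norm_num)]
    exact lt_trans (by norm_num) smythTheta_gt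
  · have h3 := smythTheta_cube
    have hu : smythTheta⁻¹ * smythTheta = 1 := inv_mul_cancel₀ hpos.ne'
    linear_combination (-(smythTheta⁻¹ ^ 3)) * h3 +
      (smythTheta⁻¹ ^ 2 * smythTheta ^ 2 + smythTheta⁻¹ * smythTheta + 1 - smythTheta⁻¹ ^ 2) * hu

/-! ### `M(Q₀(bX^k)) = θ₀` and a divisibility lemma -/

/-- `M(1 - bX^k + bX^{3k}) = θ₀` for `b = ±1`, `k ≥ 1` (`= M(Q₀(bX^k))`, `Q₀ = 1 - z + z³`). -/
theorem intMahlerMeasure_smythQ0a {b : ℤ} (hb : b = 1 ∨ b = -1) {k : ℕ} (hk : 1 ≤ k) :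
    intMahlerMeasure (1 - C b * X ^ k + C b * X ^ (3 * k) : ℤ[X]) = smythTheta := by
  rcases hb with h | h <;> subst h
  · have e : (1 - C (1 : ℤ) * X ^ k + C (1 : ℤ) * X ^ (3 * k) : ℤ[X]) =
        (-((X ^ 3 - X - 1 : ℤ[X]).comp (-X))).comp (X ^ k) := by
      simp only [sub_comp, pow_comp, X_comp, one_comp, neg_comp, map_one]; ring
    rw [e, intMahlerMeasure_comp_X_pow _ hk, intMahlerMeasure_neg, intMahlerMeasure_comp_neg_X,
      intMahlerMeasure_X_cube_sub_X_sub_one]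
  · have e : (1 - C (-1 : ℤ) * X ^ k + C (-1 : ℤ) * X ^ (3 * k) : ℤ[X]) =
        (-(X ^ 3 - X - 1 : ℤ[X])).comp (X ^ k) := by
      simp only [sub_comp, pow_comp, X_comp, one_comp, neg_comp, map_neg, map_one]; ring
    rw [e, intMahlerMeasure_comp_X_pow _ hk, intMahlerMeasure_neg, intMahlerMeasure_X_cube_sub_X_sub_one]

/-- If `P` is monic irreducible with `P(0) = ε = ±1`, `P* ≠ εP`, and `P ∣ P*·Q` with `Q(0) ≠ 0`, then
`M(P) ≤ M(Q)`. -/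
theorem intMahlerMeasure_le_of_dvd_reverse_mul {P Q : ℤ[X]} (hmonic : P.Monic) (hirr : Irreducible P)
    {ε : ℤ} (hε : P.coeff 0 = ε) (hε1 : ε * ε = 1) (hne : P.reverse ≠ C ε * P) (hQ : Q.coeff 0 ≠ 0)
    (hdvd : P ∣ P.reverse * Q) : intMahlerMeasure P ≤ intMahlerMeasure Q := by
  rcases hirr.prime.dvd_or_dvd hdvd with h | h
  · exact absurd (reverse_eq_of_dvd hmonic hε hε1 h) hne
  · obtain ⟨q, hq⟩ := h
    have hq0 : q ≠ 0 := by
      rintro rfl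
      rw [mul_zero] at hq
      exact hQ (by rw [hq, coeff_zero])
    rw [hq, intMahlerMeasure_mul]
    have h1 : 1 ≤ intMahlerMeasure q := one_le_intMahlerMeasure hq0
    have h0 : 0 ≤ intMahlerMeasure P := by unfold intMahlerMeasure; exact mahlerMeasure_nonneg _
    nlinarith

/-! ### Case `ℓ ≥ 2k+1`: `M(P) = θ₀` or `M(P) ≥ 1.325` -/

/-- **Isolation, case `ℓ > 2k`** ([McKee–Smyth §12.2.3–12.2.6]).  Let `P` be monic with `P(0) = ε = ±1`,
`M(P) > 1`, and `εP = P*(1 + aX^k) + X^{2k+1}R` with `a = ±1`, `k ≥ 1`.  Suppose that the degenerate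
alternative `εP·Q₀(aX^k) = P*·P₀(aX^k)` forces `M(P) ≤ θ₀` (true for irreducible `P`, see
`intMahlerMeasure_le_smythTheta_of_smythD_eq_zero`).  Then `M(P) = θ₀` or `M(P) ≥ 1.325`. -/
theorem smyth_isolation_caseB {P R : ℤ[X]} (hmonic : P.Monic) {ε : ℤ} (hε : P.coeff 0 = ε)
    (hε1 : ε * ε = 1) {a : ℤ} (ha : a = 1 ∨ a = -1) {k : ℕ} (hk : 1 ≤ k)
    (hid : C ε * P = P.reverse * (1 + C a * X ^ k) + X ^ (2 * k + 1) * R)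
    (hM1 : 1 < intMahlerMeasure P)
    (hD0 : C ε * P * (1 - C a * X ^ k + C a * X ^ (3 * k)) = P.reverse * (1 - X ^ (2 * k) + C a * X ^ (3 * k)) →
      intMahlerMeasure P ≤ smythTheta) :
    intMahlerMeasure P = smythTheta ∨ (1325 : ℝ) / 1000 ≤ intMahlerMeasure P := by
  set M := intMahlerMeasure P with hM
  have hMpos : 0 < M := lt_trans one_pos hM1
  have haa : a * a = 1 := by rcases ha with h | h <;> subst h <;> norm_num
  have ha0 : a ≠ 0 := by rintro rfl; simp at haa
  have haR : (a : ℝ) = 1 ∨ (a : ℝ) = -1 := by rcases ha with h | h <;> simp [h]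
  have haaR : (a : ℝ) * a = 1 := by exact_mod_cast haa
  -- Smyth data and the relations at orders `k`, `2k`
  obtain ⟨f, g, c, D, hcM, hfg⟩ := exists_smythData hmonic hε hε1 hM1
  have hid' : C ε * P = P.reverse * (1 + C a * X ^ k) + C 0 * X ^ (2 * k) + X ^ (2 * k + 1) * R := by
    rw [hid, map_zero, zero_mul, add_zero]
  have hrel := smyth_relations_re hmonic hid' D hfg
  by_cases hc : c < 3 / 4
  · right
    have h1 : M⁻¹ < 3 / 4 := hcM ▸ hc
    rw [inv_lt_comm₀ hMpos (by norm_num)] at h1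
    norm_num at h1
    linarith
  push Not at hc
  have hrelk : (jetCoeff f k).re = (jetCoeff g k).re + a * c := by
    have h := hrel k (by omega)
    rw [if_pos le_rfl, if_neg (by omega), Nat.sub_self, D.symm.re_f0] at h
    linarith
  have hrel2k : (jetCoeff f (2 * k)).re = (jetCoeff g (2 * k)).re + a * (jetCoeff g k).re := by
    have h := hrel (2 * k) le_rfl
    rw [if_pos (by omega), if_pos rfl, show 2 * k - k = k by omega] at h
    push_cast at h; linarith
  -- Smyth's inequality `θ₀ ≤ M`
  have hθM : smythTheta ≤ M := by
    have key := D.caseB hk ha0 hc hrelk hrel2k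
    rw [hcM] at key
    exact smythTheta_le_of_inv hMpos key
  -- the discrepancy polynomial `D = εP·Q₀(aX^k) - P*·P₀(aX^k)`
  set DZ : ℤ[X] := C ε * P * (1 - C a * X ^ k + C a * X ^ (3 * k)) -
    P.reverse * (1 - X ^ (2 * k) + C a * X ^ (3 * k)) with hDZ
  by_cases hDz : DZ = 0
  · exact Or.inl (le_antisymm (hD0 (sub_eq_zero.mp hDz)) hθM)
  right
  -- constants
  obtain ⟨hCCi, hC1, hC2, hCeq⟩ := smythTheta_inv_facts
  set C₀ : ℝ := smythTheta⁻¹ with hC₀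
  -- Lemma 12.17
  obtain ⟨hcC, hFk, hGk, hG2k⟩ := smyth_lemma_12_17 haR hc D.clt hC1 hC2 hCeq (D.abs_re_le hk) hrelk hrel2k
    (D.two_mul_bounds hk) (D.symm.two_mul_bounds hk)
  -- the gap `C₀ - c ≥ 2.9·10⁻⁴`
  have hgap : (29 : ℝ) / 100000 ≤ C₀ - c := by
    by_contra hlt
    push Not at hlt
    have hδ3 : C₀ - c < 1 / 1000 := by linarith
    -- the first nonzero coefficient of `D`, at an index `p ≥ 2k+1`
    have hR : X * R.divX + C (R.coeff 0) = R := by rw [mul_comm]; exact R.divX_mul_X_add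
    have hid'' : C ε * P = P.reverse * (1 + C a * X ^ k) + C (R.coeff 0) * X ^ (2 * k + 1) +
        X ^ (2 * k + 1 + 1) * R.divX := by
      rw [hid]; conv_lhs => rw [← hR]
      ring
    have hX : X ^ (2 * k + 1) ∣ DZ := X_pow_dvd_smythD hk le_rfl haa hid''
    set p := DZ.natTrailingDegree with hp
    have hbelow : ∀ j < p, DZ.coeff j = 0 := fun j hj => coeff_eq_zero_of_lt_natTrailingDegree hj
    have hp2k : 2 * k + 1 ≤ p := le_natTrailingDegree hDz (fun m hm => (X_pow_dvd_iff.mp hX) m hm)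
    have hDp : DZ.coeff p ≠ 0 := trailingCoeff_eq_zero.not.mpr hDz
    -- complex side: `Γ = f·Q₀(aX^k)`, `W = g·P₀(aX^k)`, `A = P*·P₀(aX^k)`
    set ar : ℝ := (a : ℝ) with har
    set Q0c : ℂ[X] := C ((1 : ℝ) : ℂ) * X ^ 0 + C ((-ar : ℝ) : ℂ) * X ^ k + C ((ar : ℝ) : ℂ) * X ^ (3 * k)
      with hQ0c
    set P0c : ℂ[X] := C ((1 : ℝ) : ℂ) * X ^ 0 + C ((-1 : ℝ) : ℂ) * X ^ (2 * k) + C ((ar : ℝ) : ℂ) * X ^ (3 * k)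
      with hP0c
    set Pc := P.map (Int.castRingHom ℂ) with hPc
    set Prc := P.reverse.map (Int.castRingHom ℂ) with hPrc
    set Dc := DZ.map (Int.castRingHom ℂ) with hDc
    set A : ℂ[X] := Prc * P0c with hA
    set Γ : ℂ → ℂ := fun z => f z * Q0c.eval z with hΓ
    set W : ℂ → ℂ := fun z => g z * P0c.eval z with hW
    have hΓd : DifferentiableOn ℂ Γ (ball 0 1) := D.hf.differentiableOn.mul Q0c.differentiable.differentiableOn
    have hWd : DifferentiableOn ℂ W (ball 0 1) := D.hg.differentiableOn.mul P0c.differentiable.differentiableOn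
    have hPrc0 : Prc.coeff 0 = 1 := by
      rw [hPrc, coeff_map, coeff_zero_reverse, hmonic.leadingCoeff]; simp
    have hk0 : k ≠ 0 := by omega
    have hP0c0 : P0c.coeff 0 = 1 := by
      rw [hP0c]
      simp only [coeff_add, coeff_C_mul_X_pow, if_true]
      rw [if_neg (by omega), if_neg (by omega)]; simp
    have hA0 : A.coeff 0 = 1 := by rw [hA, mul_coeff_zero, hPrc0, hP0c0, one_mul]
    have hDc0 : ∀ j < p, Dc.coeff j = 0 := fun j hj => by rw [hDc, coeff_map, hbelow j hj]; simp
    have harC : ((ar : ℝ) : ℂ) = (a : ℂ) := by rw [har]; push_cast; rfl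
    have hidfun : ∀ z ∈ ball (0 : ℂ) 1, Γ z * A.eval z = W z * (A.eval z + Dc.eval z) := by
      intro z hz
      have h := hfg z hz
      simp only [hΓ, hW, hA, hDc, hDZ, hQ0c, hP0c, Polynomial.map_sub, Polynomial.map_mul, Polynomial.map_add,
        Polynomial.map_pow, Polynomial.map_one, Polynomial.map_C, Polynomial.map_X]
      simp only [eval_sub, eval_mul, eval_add, eval_pow, eval_one, eval_C, eval_X, eq_intCast, harC]
      rw [← hPc, ← hPrc]
      push_cast
      linear_combination ((1 : ℂ) - (a : ℂ) * z ^ k + (a : ℂ) * z ^ (3 * k)) *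
        ((1 : ℂ) - z ^ (2 * k) + (a : ℂ) * z ^ (3 * k)) * h
    obtain ⟨-, hdiff⟩ := jetCoeff_eq_below_and_at one_pos hΓd hWd A Dc hA0 hDc0 hidfun
    -- `jet_0 W = c`, `Dc_p = D_p`
    have hg0 : g 0 = (c : ℂ) := by rw [← D.g0, jetCoeff_zero]
    have hW0 : jetCoeff W 0 = c := by
      rw [jetCoeff_zero, hW]
      show g 0 * P0c.eval 0 = c
      rw [← coeff_zero_eq_eval_zero, hP0c0, mul_one, hg0]
    have hDcp : Dc.coeff p = ((DZ.coeff p : ℤ) : ℂ) := by rw [hDc, coeff_map]; simp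
    rw [hW0, hDcp] at hdiff
    -- real parts of the jets of `Γ`, `W` at `p`
    set F : ℕ → ℝ := fun n => (jetCoeff f n).re with hFdef
    set G : ℕ → ℝ := fun n => (jetCoeff g n).re with hGdef
    have hF : ∀ n, ((F n : ℝ) : ℂ) = jetCoeff f n := fun n => D.re_f n
    have hG : ∀ n, ((G n : ℝ) : ℂ) = jetCoeff g n := fun n => D.symm.re_f n
    have hΓp : jetCoeff Γ p = ((F p - ar * F (p - k) + (if 3 * k ≤ p then ar * F (p - 3 * k) else 0) : ℝ) : ℂ) := by
      rw [hΓ, hQ0c, jetCoeff_mul_trinomial_real one_pos D.hf.differentiableOn hF, if_pos (Nat.zero_le p),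
        if_pos (by omega : k ≤ p), Nat.sub_zero]
      congr 1
      split_ifs <;> ring
    have hWp : jetCoeff W p = ((G p - G (p - 2 * k) + (if 3 * k ≤ p then ar * G (p - 3 * k) else 0) : ℝ) : ℂ) := by
      rw [hW, hP0c, jetCoeff_mul_trinomial_real one_pos D.hg.differentiableOn hG, if_pos (Nat.zero_le p),
        if_pos (by omega : 2 * k ≤ p), Nat.sub_zero]
      congr 1
      split_ifs <;> ring
    rw [hΓp, hWp] at hdiff
    have hdiffR : (F p - ar * F (p - k) + (if 3 * k ≤ p then ar * F (p - 3 * k) else 0)) -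
        (G p - G (p - 2 * k) + (if 3 * k ≤ p then ar * G (p - 3 * k) else 0)) = c * (DZ.coeff p : ℝ) := by
      exact_mod_cast hdiff
    -- `|γ_p - w_p| ≥ c ≥ 3/4`
    have hbig : 3 / 4 ≤ |(F p - ar * F (p - k) + (if 3 * k ≤ p then ar * F (p - 3 * k) else 0)) -
        (G p - G (p - 2 * k) + (if 3 * k ≤ p then ar * G (p - 3 * k) else 0))| := by
      rw [hdiffR, abs_mul, abs_of_pos D.cpos]
      have h1 : (1 : ℝ) ≤ |(DZ.coeff p : ℝ)| := by
        rw [← Int.cast_abs]; exact_mod_cast Int.one_le_abs hDp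
      nlinarith [D.cpos]
    -- `|γ_p - w_p| ≤ 44 √(C₀ - c)` (Lemmas 12.18, 12.19)
    have hsmall := smyth_12_49 (F := F) (G := G)
      (fco := fun n => F n + if k ≤ n then ar * C₀ * F (n - k) else 0)
      (gco := fun n => smythTheta * G n - (if k ≤ n then ar * (1 + C₀) * G (n - k) else 0) +
        (if 2 * k ≤ n then G (n - 2 * k) else 0))
      hk haR hc hcC hδ3 hC1 hC2 hCeq hCCi D.re_f0 D.symm.re_f0 hFk hGk hG2k (fun n => rfl) (fun n => rfl)
      (hardy_budget_f D.hf hF haaR hk) (hardy_budget_g D.hg hG haaR hk) hp2k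
    -- `√(C₀ - c) ≥ 3/176`
    have hs := le_trans hbig hsmall
    have hs0 : 0 ≤ C₀ - c := sub_nonneg.mpr hcC
    have hsq : Real.sqrt (C₀ - c) ^ 2 = C₀ - c := Real.sq_sqrt hs0
    nlinarith [Real.sqrt_nonneg (C₀ - c)]
  -- from the gap: `c ≤ C₀ - 0.00029 < 0.7547`, so `M = 1/c ≥ 1.325`
  have hcle : c ≤ 7547 / 10000 := by linarith
  have hMc : M = c⁻¹ := by rw [hcM, inv_inv]
  rw [hMc, le_inv_comm₀ (by norm_num) D.cpos]
  linarith

end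

end Summit.Ventures.DiscreteObjects.Mahler
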